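import Literature.NumberTheory.LFunctions.ZetaZeroSumsLehmanExplicit
import Literature.NumberTheory.LFunctions.SelbergFujiiMoments
import Literature.NumberTheory.LFunctions.ZetaZeroCountExplicit
import HarnessLib

/-!
# RH-FREE — The refined Lehman lemma of Brent–Platt–Trudgian 2021 (Lemma 3: the error `E₂ = −∫ φ'Q` is `≤ 2(A₀ + A₁ log T₁)|φ'(T₁)| + (A₁ + A₂)φ(T₁)/T₁`), PROVED by partial summation against `S₁` («nothing here bears on the truth of RH»)

Topic `Literature/NumberTheory/LFunctions` (RH literature-typing tranche 1, L4 "explicit zero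
statistics", gen 3). Label: **RH-FREE** — unconditional statements about the ordinates of the
zeros of `ζ`; THEOREMS only (no definition, no new named fact). Nothing here bears on the truth
of RH.

Source: R. P. Brent, D. J. Platt, T. S. Trudgian, *Accurate estimation of sums over zeros of the
Riemann zeta-function*, Math. Comp. 90 (2021) 2923–2935 = arXiv:2009.13791, §§2–5
`[corpus:paper:arxiv-2009.13791 p0003–p0007]`. With `N(T) = L(T) + Q(T)`,
`L(T) = (T/2π)(log(T/2π) − 1) + 7/8` (the tree's `SchoenfeldBound.countMain`), `S(T)` the argument
(the tree's `zetaArgS = N − θ/π − 1`), `S₁(T) = ∫₀^T S`, and a test function `φ ≥ 0` with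
`φ' ≤ 0`, `φ'' ≥ 0`:

* **Lemma 3** ("the key result"). "If `2π ≤ T₀ ≤ T₁ ≤ T₂` and
  `E(T₁,T₂) := Σ'_{T₁≤γ≤T₂} φ(γ) − (1/2π)∫_{T₁}^{T₂} φ(t) log(t/2π) dt`, then
  `E(T₁,T₂) = φ(T₂)Q(T₂) − φ(T₁)Q(T₁) + E₂(T₁,T₂)`, where `E₂(T₁,T₂) = −∫_{T₁}^{T₂} φ'(t)Q(t) dt`,
  and `|E₂(T₁,T₂)| ≤ 2(A₀ + A₁ log T₁)|φ'(T₁)| + (A₁ + A₂)φ(T₁)/T₁`." Here `A₀, A₁` are constants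
  with `|S₁(t) − c₀| ≤ A₀ + A₁ log t` for `t ≥ T₀` (their (2.9): `A₀ = 2.067`, `A₁ = 0.059`,
  `c₀ = S₁(168π)`, from Trudgian 2011 for `t ≥ 168π` and "a small computation" on `[2π, 168π]`),
  and `A₂` one with `|Q(t) − S(t)| ≤ A₂/t` (their Lemma 2: `A₂ = 1/150`, `t ≥ 2π`).
* **Theorems 1 and 3** restate the bound for `T₂ → ∞` (convergent sums, resp. the constant
  `F(T₀)` of a divergent sum): the error term `E₂` "is the same as in Lemma 3"; they are the
  limits of the finite statement and are not typed separately. **Theorem 2** (existence of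
  `F(T₀)`) and the examples (`c₁`, `c₂`; Corollaries 1–2) are not typed here (`c₁`, `H` are the
  named facts `BrentPlattTrudgian2021_cor1`, `BrentPlattTrudgian2021BAMS_thm1` of
  `ZetaZeroSumsLehmanExplicit.lean`).

## What is proved (no hypotheses beyond the printed ones, which are explicit arguments)

The printed proof is followed line by line ((3.3)–(3.9)): the identity (3.1)/(3.3) is the tree's
`lehman_identity` (`ZetaZeroSumsLehmanExplicit.lean`); the new ingredient is the second partial
summation `∫φ'S = [φ'(S₁−c₀)] − ∫φ''(S₁−c₀)`, done here by the fundamental theorem of calculus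
with RIGHT derivatives (`S = N − θ/π − 1` is right-continuous because the ordinates are discrete,
so `t ↦ ∫_a^t S` has right derivative `S(t)` everywhere; `continuousWithinAt_zetaArgS_Ici`,
`hasDerivWithinAt_integral_zetaArgS`, `integral_zetaArgS_mul_eq_sub` — the same three lemmas are
proved, for a different purpose, in the Summits file `LiCoefficientsLiWindowTuring.lean`, which a
Literature file may not import), then `|∫φ''(S₁−c₀)| ≤ ∫φ''(A₀ + A₁ log t)`, a third integration by
parts, and "terms involving `T₂` cancel".

* `abs_integral_deriv_mul_zetaArgS_le` — (3.9) with the base point `a` of `S₁ − c₀ = ∫_a^t S` free: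
  `|∫_{T₁}^{T₂} φ'S| ≤ (|∫_a^{T₁} S| + A₀ + A₁ log T₁)|φ'(T₁)| + A₁(φ(T₁) − φ(T₂))/T₁`
  (so `= (A₀ + A₁ log T₁)|φ'(T₁)| + …` when `a = T₁`, and `≤ 2(A₀ + A₁ log T₁)|φ'(T₁)| + …` in general);
* `abs_integral_deriv_mul_count_sub_countMain_sub_zetaArgS_le` — (3.4)–(3.5):
  `|∫φ'(Q − S)| ≤ A₂(φ(T₁) − φ(T₂))/T₁`;
* `BrentPlattTrudgian2021_lemma3_E2` — **(3.2)**: `|∫_{T₁}^{T₂} φ'Q| ≤ 2(A₀ + A₁ log T₁)|φ'(T₁)| + (A₁ + A₂)φ(T₁)/T₁`,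
  for any `0 < T₁ ≤ T₂`, `A₁ ≥ 0`, `φ ∈ C²[T₁,T₂]` with `φ' ≤ 0 ≤ φ''`, `φ(T₂) ≥ 0`, and the two
  hypotheses on `[T₁, T₂]`; `BrentPlattTrudgian2021_lemma3` — **Lemma 3** in the tree's vocabulary:
  `|Σ_{T₁<γ≤T₂} m(ρ)φ(γ) − (1/2π)∫φ log(t/2π) − (φ(T₂)Q(T₂) − φ(T₁)Q(T₁))| ≤ (the same)`;
  `BrentPlattTrudgian2021_lemma3_sharp` — with the base point `T₁` the factor `2` drops.
* Explicit instances: `BrentPlattTrudgian2021_lemma3_of_trudgian` — for `168π < T₁ ≤ T₂`, from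
  Trudgian 2011, Thm. 2.2 (`(hTr : abs_integral_zetaArgS_le_trudgian)`, a named fact of
  `TuringMethod.lean` DISCHARGED in the tree by `abs_integral_zetaArgS_le_trudgian_holds`) and the
  tree's proved `|Q − S| ≤ 1.2/(πt)` (`abs_zetaZeroCount_sub_main_sub_zetaArgS_le`): the bound
  `(2.067 + 0.059 log T₁)|φ'(T₁)| + (0.059 + 1.2/π)φ(T₁)/T₁` — an unconditional tree theorem once
  `hTr` is fed its `_holds`; `BrentPlattTrudgian2021_lemma3_printed` — for `2π ≤ T₁ ≤ T₂` with the
  printed constants `2(2.067 + 0.059 log T₁)|φ'(T₁)| + (0.059 + 1/150)φ(T₁)/T₁`, from the standing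
  condition (2.9) on `[2π, ∞)` (the hypothesis `h29`, = the named fact `BrentPlattTrudgian2021_eq29`
  of `ZetaZeroSumsLehmanExplicit.lean`) and Lemma 2 (`BrentPlattTrudgian2021_lemma2`).

Conventions: BPT's `N`, `S` are averaged at the ordinates and their sums carry weights `½` at the
end-points; the tree's `N`, `S` are right-continuous and its sums are over `T₁ < γ ≤ T₂`
(`zerosBetween T₁ T₂`, multiplicities `riemannZetaZeroOrder`). The identity (3.1) holds verbatim in
the right-continuous convention (`lehman_identity`), and (3.2) concerns integrals only.

## References

* R. P. Brent, D. J. Platt, T. S. Trudgian, Math. Comp. 90 (2021) 2923–2935, §2 (2.9), Lemma 2,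
  §3 Lemma 3 with (3.1)–(3.9), §§4–5 Theorems 1–3. [BrentPlattTrudgian2021]
* T. S. Trudgian, *Improvements to Turing's method*, Math. Comp. 80 (2011), Thm. 2.2. [Trudgian2011]
* R. S. Lehman, Acta Arith. 11 (1966) 397–410, Lemma. [Lehman1966]
-/

noncomputable section

open Complex Filter Set MeasureTheory intervalIntegral
open scoped Real Topology

namespace Literature.NumberTheory.LFunctions

open SchoenfeldBound

/-! ## `S` is right-continuous and its primitive has right derivative `S` -/

/-- `N` is locally constant to the right: `N(u) = N(t)` for `u` slightly above `t ≥ 0` (the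
ordinates in `(t, t+1]` form a finite set). [cite: BrentPlattTrudgian2021, §2 (conventions for N, S)] -/
private theorem zetaZeroCount_eventuallyEq_nhdsGT {t : ℝ} (ht : 0 ≤ t) :
    ∀ᶠ u in 𝓝[>] t, (zetaZeroCount u : ℝ) = zetaZeroCount t := by
  classical
  obtain ⟨t₁, ht₁, hfree⟩ : ∃ t₁, t < t₁ ∧ ∀ ρ ∈ zerosBetween t (t + 1), t₁ ≤ ρ.im := by
    by_cases hne : (zerosBetween t (t + 1)).Nonempty
    · obtain ⟨ρ₀, hρ₀, hmin⟩ := Finset.exists_min_image (zerosBetween t (t + 1)) (fun ρ ↦ ρ.im) hne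
      obtain ⟨-, -, -, h3, -⟩ := (mem_zerosBetween ht).1 hρ₀
      exact ⟨ρ₀.im, h3, fun ρ hρ ↦ hmin ρ hρ⟩
    · exact ⟨t + 1, by linarith, fun ρ hρ ↦ absurd ⟨ρ, hρ⟩ hne⟩
  have hmem : Ioo t (min t₁ (t + 1)) ∈ 𝓝[>] t := Ioo_mem_nhdsGT (lt_min ht₁ (by linarith))
  filter_upwards [hmem] with u hu
  have hu1 : u < t₁ := lt_of_lt_of_le hu.2 (min_le_left _ _)
  have hu2 : u ≤ t + 1 := (lt_of_lt_of_le hu.2 (min_le_right _ _)).le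
  have hempty : zerosBetween t u = ∅ := by
    rw [Finset.eq_empty_iff_forall_notMem]
    intro ρ hρ
    obtain ⟨hz, h0, h1, h3, h4⟩ := (mem_zerosBetween ht).1 hρ
    have hρ' : ρ ∈ zerosBetween t (t + 1) := (mem_zerosBetween ht).2 ⟨hz, h0, h1, h3, h4.trans hu2⟩
    have := hfree ρ hρ'
    linarith
  have h := zetaZeroCount_sub_eq_sum (T₁ := t) (T₂ := u) hu.1.le
  rw [hempty, Finset.sum_empty] at h
  linarith

/-- `S = N − θ/π − 1` is continuous from the right at every `t ≥ 0`.
[cite: BrentPlattTrudgian2021, §2 (conventions for N, S)] -/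
theorem continuousWithinAt_zetaArgS_Ici {t : ℝ} (ht : 0 ≤ t) : ContinuousWithinAt zetaArgS (Ici t) t := by
  rw [← continuousWithinAt_Ioi_iff_Ici]
  have hN : Tendsto (fun u ↦ (zetaZeroCount u : ℝ)) (𝓝[>] t) (𝓝 (zetaZeroCount t : ℝ)) :=
    (tendsto_congr' (zetaZeroCount_eventuallyEq_nhdsGT ht)).2 tendsto_const_nhds
  have hθ : Tendsto (fun u ↦ riemannSiegelTheta u / π + 1) (𝓝[>] t)
      (𝓝 (riemannSiegelTheta t / π + 1)) :=
    ((continuous_riemannSiegelTheta.div_const π).add continuous_const).continuousAt.continuousWithinAt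
  have e : zetaArgS = fun u ↦ (zetaZeroCount u : ℝ) - (riemannSiegelTheta u / π + 1) := by
    funext u; simp only [zetaArgS]; ring
  show Tendsto zetaArgS (𝓝[>] t) (𝓝 (zetaArgS t))
  rw [e]
  exact hN.sub hθ

/-- The primitive `t ↦ ∫_a^t S` has right derivative `S(t)` at every `t ≥ 0` (`S₁' = S` from the
right). [cite: BrentPlattTrudgian2021, §2 (definition of S₁)] -/
theorem hasDerivWithinAt_integral_zetaArgS (a : ℝ) {t : ℝ} (ht : 0 ≤ t) :
    HasDerivWithinAt (fun u ↦ ∫ x in a..u, zetaArgS x) (zetaArgS t) (Ici t) t :=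
  intervalIntegral.integral_hasDerivWithinAt_right (intervalIntegrable_zetaArgS a t)
    (s := Ici t) (t := Ioi t) (SelbergFujii.measurable_zetaArgS.aestronglyMeasurable.stronglyMeasurableAtFilter)
    ((continuousWithinAt_zetaArgS_Ici ht).mono Ioi_subset_Ici_self)

/-- The primitive of `S` is continuous. [cite: BrentPlattTrudgian2021, §2 (definition of S₁)] -/
theorem continuous_integral_zetaArgS (a : ℝ) : Continuous fun u ↦ ∫ x in a..u, zetaArgS x :=
  intervalIntegral.continuous_primitive (fun a b ↦ intervalIntegrable_zetaArgS a b) a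

/-! ## Integration by parts against `S` (the Stieltjes step (3.6) of the source) -/

/-- **Partial summation against `S₁`** (FTC with right derivatives): for `0 ≤ T₁ ≤ T₂`,
`g ∈ C¹[T₁,T₂]` and any base point `a`, with `F(t) = ∫_a^t S`,
`∫_{T₁}^{T₂} S g = F(T₂)g(T₂) − F(T₁)g(T₁) − ∫_{T₁}^{T₂} F g'`.
[cite: BrentPlattTrudgian2021, Lemma 3 (proof, display before (3.7))] -/
theorem integral_zetaArgS_mul_eq_sub {a T₁ T₂ : ℝ} (h0 : 0 ≤ T₁) (h12 : T₁ ≤ T₂) {g g' : ℝ → ℝ}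
    (hg : ∀ t ∈ Icc T₁ T₂, HasDerivAt g (g' t) t) (hg' : ContinuousOn g' (Icc T₁ T₂)) :
    ∫ t in T₁..T₂, zetaArgS t * g t =
      (∫ x in a..T₂, zetaArgS x) * g T₂ - (∫ x in a..T₁, zetaArgS x) * g T₁
        - ∫ t in T₁..T₂, (∫ x in a..t, zetaArgS x) * g' t := by
  set F : ℝ → ℝ := fun u ↦ ∫ x in a..u, zetaArgS x with hF
  have hFcont : Continuous F := continuous_integral_zetaArgS a
  have hgcont : ContinuousOn g (Icc T₁ T₂) := fun t ht ↦ (hg t ht).continuousAt.continuousWithinAt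
  have hderiv : ∀ t ∈ Ioo T₁ T₂,
      HasDerivWithinAt (fun u ↦ F u * g u) (zetaArgS t * g t + F t * g' t) (Ioi t) t := by
    intro t ht
    have h1 := (hasDerivWithinAt_integral_zetaArgS a (h0.trans ht.1.le)).mono Ioi_subset_Ici_self
    have h2 := (hg t ⟨ht.1.le, ht.2.le⟩).hasDerivWithinAt (s := Ioi t)
    exact h1.mul h2
  have hSg : IntervalIntegrable (fun t ↦ zetaArgS t * g t) volume T₁ T₂ :=
    (intervalIntegrable_zetaArgS T₁ T₂).mul_continuousOn (by rwa [uIcc_of_le h12])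
  have hFg' : IntervalIntegrable (fun t ↦ F t * g' t) volume T₁ T₂ :=
    (hFcont.continuousOn.mul hg').intervalIntegrable_of_Icc h12
  have hFTC := intervalIntegral.integral_eq_sub_of_hasDeriv_right_of_le h12
    (hFcont.continuousOn.mul hgcont) hderiv (hSg.add hFg')
  rw [intervalIntegral.integral_add hSg hFg'] at hFTC
  simp only [Pi.mul_apply] at hFTC
  linarith

/-! ## Brent–Platt–Trudgian 2021, Lemma 3: the bound for `E₂ = −∫ φ'Q` -/

/-- **(3.6)–(3.9) of the source, with the base point free.** For `0 < T₁ ≤ T₂`, `A₁ ≥ 0`,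
`φ ∈ C²[T₁,T₂]` with `φ' ≤ 0 ≤ φ''`, and `|∫_a^t S| ≤ A₀ + A₁ log t` on `[T₁,T₂]`:
`|∫_{T₁}^{T₂} φ'S| ≤ (|∫_a^{T₁} S| + A₀ + A₁ log T₁)(−φ'(T₁)) + A₁(φ(T₁) − φ(T₂))/T₁`
("terms involving `T₂` cancel"). [cite: BrentPlattTrudgian2021, Lemma 3 (proof, (3.6)–(3.9))] -/
theorem abs_integral_deriv_mul_zetaArgS_le {a T₁ T₂ A₀ A₁ : ℝ} (h0 : 0 < T₁) (h12 : T₁ ≤ T₂)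
    (hA₁ : 0 ≤ A₁) {φ φ' φ'' : ℝ → ℝ}
    (hφ : ∀ t ∈ Icc T₁ T₂, HasDerivAt φ (φ' t) t) (hφ' : ∀ t ∈ Icc T₁ T₂, HasDerivAt φ' (φ'' t) t)
    (hφ'' : ContinuousOn φ'' (Icc T₁ T₂)) (hφ'0 : ∀ t ∈ Icc T₁ T₂, φ' t ≤ 0)
    (hφ''0 : ∀ t ∈ Icc T₁ T₂, 0 ≤ φ'' t)
    (hS1 : ∀ t ∈ Icc T₁ T₂, |∫ x in a..t, zetaArgS x| ≤ A₀ + A₁ * Real.log t) :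
    |∫ t in T₁..T₂, φ' t * zetaArgS t| ≤
      (|∫ x in a..T₁, zetaArgS x| + (A₀ + A₁ * Real.log T₁)) * (-φ' T₁)
        + A₁ * (φ T₁ - φ T₂) / T₁ := by
  have hIcc : uIcc T₁ T₂ = Icc T₁ T₂ := uIcc_of_le h12
  set F : ℝ → ℝ := fun u ↦ ∫ x in a..u, zetaArgS x with hF
  have hFcont : Continuous F := continuous_integral_zetaArgS a
  have hφ'cont : ContinuousOn φ' (Icc T₁ T₂) := fun t ht ↦ (hφ' t ht).continuousAt.continuousWithinAt
  have hφ''i : IntervalIntegrable φ'' volume T₁ T₂ := hφ''.intervalIntegrable_of_Icc h12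
  -- (3.6): ∫ φ' S = F(T₂)φ'(T₂) − F(T₁)φ'(T₁) − ∫ F φ''
  have hparts : ∫ t in T₁..T₂, φ' t * zetaArgS t =
      F T₂ * φ' T₂ - F T₁ * φ' T₁ - ∫ t in T₁..T₂, F t * φ'' t := by
    have h := integral_zetaArgS_mul_eq_sub (a := a) h0.le h12 hφ' hφ''
    have e : ∫ t in T₁..T₂, φ' t * zetaArgS t = ∫ t in T₁..T₂, zetaArgS t * φ' t :=
      intervalIntegral.integral_congr fun t _ ↦ mul_comm _ _
    rw [e, h]
  -- (3.8): |∫ F φ''| ≤ ∫ g φ'' (pointwise `|F| ≤ g`, `φ'' ≥ 0`)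
  have hgφ''i : IntervalIntegrable (fun t ↦ (A₀ + A₁ * Real.log t) * φ'' t) volume T₁ T₂ := by
    refine (ContinuousOn.mul ?_ hφ'').intervalIntegrable_of_Icc h12
    intro t ht
    have ht0 : 0 < t := h0.trans_le ht.1
    exact (continuousAt_const.add ((Real.continuousAt_log ht0.ne').const_mul A₁)).continuousWithinAt
  have hbd : |∫ t in T₁..T₂, F t * φ'' t| ≤ ∫ t in T₁..T₂, (A₀ + A₁ * Real.log t) * φ'' t := by
    have h := intervalIntegral.norm_integral_le_of_norm_le (f := fun t ↦ F t * φ'' t)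
      (g := fun t ↦ (A₀ + A₁ * Real.log t) * φ'' t) (μ := volume) h12
      (Eventually.of_forall fun t ht ↦ by
        have ht' : t ∈ Icc T₁ T₂ := ⟨ht.1.le, ht.2⟩
        rw [Real.norm_eq_abs, abs_mul, abs_of_nonneg (hφ''0 t ht')]
        exact mul_le_mul_of_nonneg_right (hS1 t ht') (hφ''0 t ht'))
      hgφ''i
    rw [Real.norm_eq_abs] at h
    exact h
  -- third integration by parts: ∫ g φ'' = g(T₂)φ'(T₂) − g(T₁)φ'(T₁) − ∫ (A₁/t) φ'
  have hg' : ∀ t ∈ uIcc T₁ T₂, HasDerivAt (fun t : ℝ ↦ A₀ + A₁ * Real.log t) (A₁ * (1 / t)) t := by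
    intro t ht
    rw [hIcc] at ht
    have ht0 : 0 < t := h0.trans_le ht.1
    have h := ((Real.hasDerivAt_log ht0.ne').const_mul A₁).const_add A₀
    rw [one_div]
    exact h
  have hφ'd : ∀ t ∈ uIcc T₁ T₂, HasDerivAt φ' (φ'' t) t := by
    intro t ht; rw [hIcc] at ht; exact hφ' t ht
  have hg'i : IntervalIntegrable (fun t : ℝ ↦ A₁ * (1 / t)) volume T₁ T₂ := by
    refine ContinuousOn.intervalIntegrable_of_Icc h12 fun t ht ↦ ?_
    have ht0 : 0 < t := h0.trans_le ht.1
    have hne : id t ≠ 0 := by simpa using ht0.ne'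
    exact ((continuousAt_const.div continuousAt_id hne).const_mul A₁).continuousWithinAt
  have hparts2 : ∫ t in T₁..T₂, (A₀ + A₁ * Real.log t) * φ'' t =
      (A₀ + A₁ * Real.log T₂) * φ' T₂ - (A₀ + A₁ * Real.log T₁) * φ' T₁
        - ∫ t in T₁..T₂, A₁ * (1 / t) * φ' t :=
    intervalIntegral.integral_mul_deriv_eq_deriv_mul hg' hφ'd hg'i hφ''i
  -- ∫ (A₁/t) φ' ≥ A₁ (φ(T₂) − φ(T₁))/T₁  (φ' ≤ 0, 1/t ≤ 1/T₁)
  have hφd : ∀ t ∈ uIcc T₁ T₂, HasDerivAt φ (φ' t) t := by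
    intro t ht; rw [hIcc] at ht; exact hφ t ht
  have hφ'i : IntervalIntegrable φ' volume T₁ T₂ := hφ'cont.intervalIntegrable_of_Icc h12
  have hintφ' : ∫ t in T₁..T₂, φ' t = φ T₂ - φ T₁ := integral_eq_sub_of_hasDerivAt hφd hφ'i
  have hlow : A₁ * (φ T₂ - φ T₁) / T₁ ≤ ∫ t in T₁..T₂, A₁ * (1 / t) * φ' t := by
    have hmono := intervalIntegral.integral_mono_on h12 (hφ'i.const_mul (A₁ / T₁))
      ((hg'i.mul_continuousOn (by rwa [hIcc])))
      (fun t ht ↦ by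
        have ht0 : 0 < t := h0.trans_le ht.1
        have h1 : 1 / t ≤ 1 / T₁ := one_div_le_one_div_of_le h0 ht.1
        have h2 : φ' t ≤ 0 := hφ'0 t ht
        show A₁ / T₁ * φ' t ≤ A₁ * (1 / t) * φ' t
        have : A₁ * (1 / t) ≤ A₁ / T₁ := by rw [div_eq_mul_one_div A₁ T₁]; gcongr
        nlinarith)
    rw [intervalIntegral.integral_const_mul, hintφ'] at hmono
    have e : A₁ / T₁ * (φ T₂ - φ T₁) = A₁ * (φ T₂ - φ T₁) / T₁ := by ring
    linarith
  -- the boundary terms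
  have hT1 : T₁ ∈ Icc T₁ T₂ := ⟨le_rfl, h12⟩
  have hT2 : T₂ ∈ Icc T₁ T₂ := ⟨h12, le_rfl⟩
  have hb2 : |F T₂ * φ' T₂| ≤ (A₀ + A₁ * Real.log T₂) * (-φ' T₂) := by
    rw [abs_mul, abs_of_nonpos (hφ'0 T₂ hT2)]
    exact mul_le_mul_of_nonneg_right (hS1 T₂ hT2) (by linarith [hφ'0 T₂ hT2])
  have hb1 : |F T₁ * φ' T₁| = |F T₁| * (-φ' T₁) := by
    rw [abs_mul, abs_of_nonpos (hφ'0 T₁ hT1)]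
  -- assemble: |∫φ'S| ≤ |Fφ'(T₂)| + |Fφ'(T₁)| + |∫Fφ''|
  have htri : |∫ t in T₁..T₂, φ' t * zetaArgS t| ≤
      |F T₂ * φ' T₂| + |F T₁ * φ' T₁| + |∫ t in T₁..T₂, F t * φ'' t| := by
    rw [hparts]
    have := abs_sub (F T₂ * φ' T₂ - F T₁ * φ' T₁) (∫ t in T₁..T₂, F t * φ'' t)
    have := abs_sub (F T₂ * φ' T₂) (F T₁ * φ' T₁)
    linarith
  rw [hb1] at htri
  have hchain : |∫ t in T₁..T₂, F t * φ'' t| ≤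
      (A₀ + A₁ * Real.log T₂) * φ' T₂ - (A₀ + A₁ * Real.log T₁) * φ' T₁ - A₁ * (φ T₂ - φ T₁) / T₁ := by
    have := hbd; rw [hparts2] at this; linarith
  have e : (|F T₁| + (A₀ + A₁ * Real.log T₁)) * (-φ' T₁) + A₁ * (φ T₁ - φ T₂) / T₁ =
      |F T₁| * (-φ' T₁) - (A₀ + A₁ * Real.log T₁) * φ' T₁ - A₁ * (φ T₂ - φ T₁) / T₁ := by
    ring
  rw [e]
  linarith

/-- **(3.4)–(3.5) of the source**: if `|Q(t) − S(t)| ≤ A₂/t` on `[T₁,T₂]` (`0 < T₁`), `φ' ≤ 0`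
continuous, then `|∫_{T₁}^{T₂} φ'(Q − S)| ≤ A₂(φ(T₁) − φ(T₂))/T₁`.
[cite: BrentPlattTrudgian2021, Lemma 3 (proof, (3.4)–(3.5))] -/
theorem abs_integral_deriv_mul_count_sub_countMain_sub_zetaArgS_le {T₁ T₂ A₂ : ℝ} (h0 : 0 < T₁)
    (h12 : T₁ ≤ T₂) {φ φ' : ℝ → ℝ}
    (hφ : ∀ t ∈ Icc T₁ T₂, HasDerivAt φ (φ' t) t) (hφ'c : ContinuousOn φ' (Icc T₁ T₂))
    (hφ'0 : ∀ t ∈ Icc T₁ T₂, φ' t ≤ 0)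
    (hQS : ∀ t ∈ Icc T₁ T₂, |((zetaZeroCount t : ℝ) - countMain t) - zetaArgS t| ≤ A₂ / t) :
    |∫ t in T₁..T₂, φ' t * (((zetaZeroCount t : ℝ) - countMain t) - zetaArgS t)| ≤
      A₂ * (φ T₁ - φ T₂) / T₁ := by
  have hIcc : uIcc T₁ T₂ = Icc T₁ T₂ := uIcc_of_le h12
  have hA₂ : 0 ≤ A₂ := by
    have h := (abs_nonneg _).trans (hQS T₁ ⟨le_rfl, h12⟩)
    exact (div_nonneg_iff.1 h).elim (fun h ↦ h.1) fun h ↦ absurd h.2 (not_le.2 h0)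
  have hφ'i : IntervalIntegrable φ' volume T₁ T₂ := hφ'c.intervalIntegrable_of_Icc h12
  have hφd : ∀ t ∈ uIcc T₁ T₂, HasDerivAt φ (φ' t) t := by
    intro t ht; rw [hIcc] at ht; exact hφ t ht
  have hintφ' : ∫ t in T₁..T₂, φ' t = φ T₂ - φ T₁ := integral_eq_sub_of_hasDerivAt hφd hφ'i
  have h := intervalIntegral.norm_integral_le_of_norm_le
    (f := fun t ↦ φ' t * (((zetaZeroCount t : ℝ) - countMain t) - zetaArgS t))
    (g := fun t ↦ -(A₂ / T₁) * φ' t) (μ := volume) h12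
    (Eventually.of_forall fun t ht ↦ by
      have ht' : t ∈ Icc T₁ T₂ := ⟨ht.1.le, ht.2⟩
      have ht0 : 0 < t := h0.trans_le ht'.1
      rw [Real.norm_eq_abs, abs_mul, abs_of_nonpos (hφ'0 t ht')]
      have h1 : A₂ / t ≤ A₂ / T₁ := div_le_div_of_nonneg_left hA₂ h0 ht'.1
      have h2 := hQS t ht'
      have h3 : 0 ≤ -φ' t := by linarith [hφ'0 t ht']
      nlinarith)
    (hφ'i.const_mul _)
  rw [intervalIntegral.integral_const_mul, hintφ'] at h
  have e : -(A₂ / T₁) * (φ T₂ - φ T₁) = A₂ * (φ T₁ - φ T₂) / T₁ := by ring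
  rw [e, Real.norm_eq_abs] at h
  exact h

/-- `φ' ≤ 0` on `[T₁, T₂]` gives `φ(T₂) ≤ φ(T₁)` (`φ ∈ C¹`). [folklore] -/
private theorem antitone_aux {T₁ T₂ : ℝ} (h12 : T₁ ≤ T₂) {φ φ' : ℝ → ℝ}
    (hφ : ∀ t ∈ Icc T₁ T₂, HasDerivAt φ (φ' t) t) (hφ'c : ContinuousOn φ' (Icc T₁ T₂))
    (hφ'0 : ∀ t ∈ Icc T₁ T₂, φ' t ≤ 0) : φ T₂ ≤ φ T₁ := by
  have hIcc : uIcc T₁ T₂ = Icc T₁ T₂ := uIcc_of_le h12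
  have hφd : ∀ t ∈ uIcc T₁ T₂, HasDerivAt φ (φ' t) t := by
    intro t ht; rw [hIcc] at ht; exact hφ t ht
  have hint := integral_eq_sub_of_hasDerivAt hφd (hφ'c.intervalIntegrable_of_Icc h12)
  have hnn : 0 ≤ ∫ t in T₁..T₂, -φ' t :=
    intervalIntegral.integral_nonneg h12 fun t ht ↦ by linarith [hφ'0 t ht]
  rw [intervalIntegral.integral_neg] at hnn
  linarith

/-- **The bound for `E₂` with the base point free** ((3.3)–(3.9) assembled): under the hypotheses
of Lemma 3 on `[T₁, T₂]` (`0 < T₁ ≤ T₂`, `A₁ ≥ 0`, `φ ∈ C²`, `φ' ≤ 0 ≤ φ''`, `φ(T₂) ≥ 0`,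
`|∫_a^t S| ≤ A₀ + A₁ log t`, `|Q − S| ≤ A₂/t`),
`|∫_{T₁}^{T₂} Q φ'| ≤ (|∫_a^{T₁} S| + A₀ + A₁ log T₁)|φ'(T₁)| + (A₁ + A₂)φ(T₁)/T₁`.
[cite: BrentPlattTrudgian2021, Lemma 3 (proof)] -/
theorem BrentPlattTrudgian2021_lemma3_E2_base {a T₁ T₂ A₀ A₁ A₂ : ℝ} (h0 : 0 < T₁) (h12 : T₁ ≤ T₂)
    (hA₁ : 0 ≤ A₁) {φ φ' φ'' : ℝ → ℝ}
    (hφ : ∀ t ∈ Icc T₁ T₂, HasDerivAt φ (φ' t) t) (hφ' : ∀ t ∈ Icc T₁ T₂, HasDerivAt φ' (φ'' t) t)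
    (hφ'' : ContinuousOn φ'' (Icc T₁ T₂)) (hφ'0 : ∀ t ∈ Icc T₁ T₂, φ' t ≤ 0)
    (hφ''0 : ∀ t ∈ Icc T₁ T₂, 0 ≤ φ'' t) (hφT : 0 ≤ φ T₂)
    (hS1 : ∀ t ∈ Icc T₁ T₂, |∫ x in a..t, zetaArgS x| ≤ A₀ + A₁ * Real.log t)
    (hQS : ∀ t ∈ Icc T₁ T₂, |((zetaZeroCount t : ℝ) - countMain t) - zetaArgS t| ≤ A₂ / t) :
    |∫ t in T₁..T₂, ((zetaZeroCount t : ℝ) - countMain t) * φ' t| ≤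
      (|∫ x in a..T₁, zetaArgS x| + (A₀ + A₁ * Real.log T₁)) * |φ' T₁| + (A₁ + A₂) * φ T₁ / T₁ := by
  have hIcc : uIcc T₁ T₂ = Icc T₁ T₂ := uIcc_of_le h12
  have hφ'c : ContinuousOn φ' (Icc T₁ T₂) := fun t ht ↦ (hφ' t ht).continuousAt.continuousWithinAt
  -- integrability of `φ'S` and `Qφ'`
  have hSφ : IntervalIntegrable (fun t ↦ φ' t * zetaArgS t) volume T₁ T₂ :=
    (intervalIntegrable_zetaArgS T₁ T₂).continuousOn_mul (by rwa [hIcc])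
  have hQφ : IntervalIntegrable (fun t ↦ ((zetaZeroCount t : ℝ) - countMain t) * φ' t) volume T₁ T₂ := by
    have h1 : IntervalIntegrable (fun t ↦ (zetaZeroCount t : ℝ) * φ' t) volume T₁ T₂ :=
      (intervalIntegrable_zetaZeroCount T₁ T₂).mul_continuousOn (by rwa [hIcc])
    have h2 : IntervalIntegrable (fun t ↦ countMain t * φ' t) volume T₁ T₂ :=
      ((continuousOn_countMain h0).mul hφ'c).intervalIntegrable_of_Icc h12
    have e : (fun t ↦ ((zetaZeroCount t : ℝ) - countMain t) * φ' t) =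
        fun t ↦ (zetaZeroCount t : ℝ) * φ' t - countMain t * φ' t := by
      funext t; ring
    rw [e]
    exact h1.sub h2
  have hQSφ : IntervalIntegrable
      (fun t ↦ φ' t * (((zetaZeroCount t : ℝ) - countMain t) - zetaArgS t)) volume T₁ T₂ := by
    have e : (fun t ↦ φ' t * (((zetaZeroCount t : ℝ) - countMain t) - zetaArgS t)) =
        fun t ↦ ((zetaZeroCount t : ℝ) - countMain t) * φ' t - φ' t * zetaArgS t := by
      funext t; ring
    rw [e]
    exact hQφ.sub hSφ
  -- (3.4): split `Q = S + (Q − S)`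
  have hsplit : ∫ t in T₁..T₂, ((zetaZeroCount t : ℝ) - countMain t) * φ' t =
      (∫ t in T₁..T₂, φ' t * zetaArgS t)
        + ∫ t in T₁..T₂, φ' t * (((zetaZeroCount t : ℝ) - countMain t) - zetaArgS t) := by
    rw [← intervalIntegral.integral_add hSφ hQSφ]
    exact intervalIntegral.integral_congr fun t _ ↦ by ring
  have hA := abs_integral_deriv_mul_zetaArgS_le (a := a) h0 h12 hA₁ hφ hφ' hφ'' hφ'0 hφ''0 hS1
  have hB := abs_integral_deriv_mul_count_sub_countMain_sub_zetaArgS_le h0 h12 hφ hφ'c hφ'0 hQS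
  have hφ'1 : φ' T₁ ≤ 0 := hφ'0 T₁ ⟨le_rfl, h12⟩
  have habs : |φ' T₁| = -φ' T₁ := abs_of_nonpos hφ'1
  have hA₂ : 0 ≤ A₂ := by
    have h := (abs_nonneg _).trans (hQS T₁ ⟨le_rfl, h12⟩)
    exact (div_nonneg_iff.1 h).elim (fun h ↦ h.1) fun h ↦ absurd h.2 (not_le.2 h0)
  have hanti : φ T₂ ≤ φ T₁ := antitone_aux h12 hφ hφ'c hφ'0
  have htail : A₁ * (φ T₁ - φ T₂) / T₁ + A₂ * (φ T₁ - φ T₂) / T₁ ≤ (A₁ + A₂) * φ T₁ / T₁ := by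
    rw [← add_div, div_le_div_iff_of_pos_right h0]
    nlinarith
  rw [hsplit, habs]
  calc |(∫ t in T₁..T₂, φ' t * zetaArgS t)
        + ∫ t in T₁..T₂, φ' t * (((zetaZeroCount t : ℝ) - countMain t) - zetaArgS t)|
      ≤ |∫ t in T₁..T₂, φ' t * zetaArgS t|
        + |∫ t in T₁..T₂, φ' t * (((zetaZeroCount t : ℝ) - countMain t) - zetaArgS t)| :=
        abs_add_le _ _
    _ ≤ (|∫ x in a..T₁, zetaArgS x| + (A₀ + A₁ * Real.log T₁)) * (-φ' T₁)
        + A₁ * (φ T₁ - φ T₂) / T₁ + A₂ * (φ T₁ - φ T₂) / T₁ := by linarith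
    _ ≤ (|∫ x in a..T₁, zetaArgS x| + (A₀ + A₁ * Real.log T₁)) * (-φ' T₁)
        + (A₁ + A₂) * φ T₁ / T₁ := by linarith

/-- **Brent–Platt–Trudgian 2021, Lemma 3, the bound (3.2) for `E₂(T₁,T₂) = −∫_{T₁}^{T₂} φ'(t)Q(t) dt`.**
For `0 < T₁ ≤ T₂`, constants `A₀`, `A₁ ≥ 0`, `A₂`, a base point `a` (the source: `a = 168π`,
i.e. `S₁(t) − c₀ = ∫_{168π}^t S`), and `φ ∈ C²[T₁,T₂]` with `φ' ≤ 0`, `φ'' ≥ 0`, `φ(T₂) ≥ 0`: if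
`|∫_a^t S| ≤ A₀ + A₁ log t` and `|Q(t) − S(t)| ≤ A₂/t` on `[T₁, T₂]`, then
`|E₂(T₁,T₂)| ≤ 2(A₀ + A₁ log T₁)|φ'(T₁)| + (A₁ + A₂)φ(T₁)/T₁`.
[cite: BrentPlattTrudgian2021, Lemma 3 eq. (3.2)] -/
theorem BrentPlattTrudgian2021_lemma3_E2 {a T₁ T₂ A₀ A₁ A₂ : ℝ} (h0 : 0 < T₁) (h12 : T₁ ≤ T₂)
    (hA₁ : 0 ≤ A₁) {φ φ' φ'' : ℝ → ℝ}
    (hφ : ∀ t ∈ Icc T₁ T₂, HasDerivAt φ (φ' t) t) (hφ' : ∀ t ∈ Icc T₁ T₂, HasDerivAt φ' (φ'' t) t)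
    (hφ'' : ContinuousOn φ'' (Icc T₁ T₂)) (hφ'0 : ∀ t ∈ Icc T₁ T₂, φ' t ≤ 0)
    (hφ''0 : ∀ t ∈ Icc T₁ T₂, 0 ≤ φ'' t) (hφT : 0 ≤ φ T₂)
    (hS1 : ∀ t ∈ Icc T₁ T₂, |∫ x in a..t, zetaArgS x| ≤ A₀ + A₁ * Real.log t)
    (hQS : ∀ t ∈ Icc T₁ T₂, |((zetaZeroCount t : ℝ) - countMain t) - zetaArgS t| ≤ A₂ / t) :
    |∫ t in T₁..T₂, ((zetaZeroCount t : ℝ) - countMain t) * φ' t| ≤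
      2 * (A₀ + A₁ * Real.log T₁) * |φ' T₁| + (A₁ + A₂) * φ T₁ / T₁ := by
  have h := BrentPlattTrudgian2021_lemma3_E2_base h0 h12 hA₁ hφ hφ' hφ'' hφ'0 hφ''0 hφT hS1 hQS
  have hF1 : |∫ x in a..T₁, zetaArgS x| ≤ A₀ + A₁ * Real.log T₁ := hS1 T₁ ⟨le_rfl, h12⟩
  have h2 : (|∫ x in a..T₁, zetaArgS x| + (A₀ + A₁ * Real.log T₁)) * |φ' T₁| ≤
      2 * (A₀ + A₁ * Real.log T₁) * |φ' T₁| := by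
    apply mul_le_mul_of_nonneg_right _ (abs_nonneg _)
    linarith
  linarith

/-- **Brent–Platt–Trudgian 2021, Lemma 3** (finite sums, in the tree's vocabulary): under the
hypotheses of `BrentPlattTrudgian2021_lemma3_E2`,
`|Σ_{T₁<γ≤T₂} m(ρ)φ(γ) − (1/2π)∫_{T₁}^{T₂} φ(t) log(t/2π) dt − (φ(T₂)Q(T₂) − φ(T₁)Q(T₁))|
  ≤ 2(A₀ + A₁ log T₁)|φ'(T₁)| + (A₁ + A₂)φ(T₁)/T₁`
(`E = φ(T₂)Q(T₂) − φ(T₁)Q(T₁) + E₂`, eq. (3.1), is the tree's `lehman_identity`).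
[cite: BrentPlattTrudgian2021, Lemma 3 (3.1)–(3.2)] -/
theorem BrentPlattTrudgian2021_lemma3 {a T₁ T₂ A₀ A₁ A₂ : ℝ} (h0 : 0 < T₁) (h12 : T₁ ≤ T₂)
    (hA₁ : 0 ≤ A₁) {φ φ' φ'' : ℝ → ℝ}
    (hφ : ∀ t ∈ Icc T₁ T₂, HasDerivAt φ (φ' t) t) (hφ' : ∀ t ∈ Icc T₁ T₂, HasDerivAt φ' (φ'' t) t)
    (hφ'' : ContinuousOn φ'' (Icc T₁ T₂)) (hφ'0 : ∀ t ∈ Icc T₁ T₂, φ' t ≤ 0)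
    (hφ''0 : ∀ t ∈ Icc T₁ T₂, 0 ≤ φ'' t) (hφT : 0 ≤ φ T₂)
    (hS1 : ∀ t ∈ Icc T₁ T₂, |∫ x in a..t, zetaArgS x| ≤ A₀ + A₁ * Real.log t)
    (hQS : ∀ t ∈ Icc T₁ T₂, |((zetaZeroCount t : ℝ) - countMain t) - zetaArgS t| ≤ A₂ / t) :
    |∑ ρ ∈ zerosBetween T₁ T₂, (riemannZetaZeroOrder ρ : ℝ) * φ ρ.im
        - (∫ t in T₁..T₂, φ t * Real.log (t / (2 * π))) / (2 * π)
        - (((zetaZeroCount T₂ : ℝ) - countMain T₂) * φ T₂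
            - ((zetaZeroCount T₁ : ℝ) - countMain T₁) * φ T₁)| ≤
      2 * (A₀ + A₁ * Real.log T₁) * |φ' T₁| + (A₁ + A₂) * φ T₁ / T₁ := by
  have hφ'c : ContinuousOn φ' (Icc T₁ T₂) := fun t ht ↦ (hφ' t ht).continuousAt.continuousWithinAt
  rw [lehman_identity h0 h12 hφ hφ'c]
  have e : (∫ t in T₁..T₂, φ t * Real.log (t / (2 * π))) / (2 * π)
      + ((zetaZeroCount T₂ : ℝ) - countMain T₂) * φ T₂
      - ((zetaZeroCount T₁ : ℝ) - countMain T₁) * φ T₁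
      - (∫ t in T₁..T₂, ((zetaZeroCount t : ℝ) - countMain t) * φ' t)
      - (∫ t in T₁..T₂, φ t * Real.log (t / (2 * π))) / (2 * π)
      - (((zetaZeroCount T₂ : ℝ) - countMain T₂) * φ T₂
          - ((zetaZeroCount T₁ : ℝ) - countMain T₁) * φ T₁) =
      -(∫ t in T₁..T₂, ((zetaZeroCount t : ℝ) - countMain t) * φ' t) := by ring
  rw [e, abs_neg]
  exact BrentPlattTrudgian2021_lemma3_E2 h0 h12 hA₁ hφ hφ' hφ'' hφ'0 hφ''0 hφT hS1 hQS

/-- **Lemma 3 with the base point `T₁`** (the factor `2` drops: `S₁ − c₀` replaced by `∫_{T₁}^t S`,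
which vanishes at `T₁`): `|Σ − (1/2π)∫φ log(t/2π) − (φ(T₂)Q(T₂) − φ(T₁)Q(T₁))| ≤
(A₀ + A₁ log T₁)|φ'(T₁)| + (A₁ + A₂)φ(T₁)/T₁`. [cite: BrentPlattTrudgian2021, Lemma 3 (proof, (3.7)–(3.9))] -/
theorem BrentPlattTrudgian2021_lemma3_sharp {T₁ T₂ A₀ A₁ A₂ : ℝ} (h0 : 0 < T₁) (h12 : T₁ ≤ T₂)
    (hA₁ : 0 ≤ A₁) {φ φ' φ'' : ℝ → ℝ}
    (hφ : ∀ t ∈ Icc T₁ T₂, HasDerivAt φ (φ' t) t) (hφ' : ∀ t ∈ Icc T₁ T₂, HasDerivAt φ' (φ'' t) t)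
    (hφ'' : ContinuousOn φ'' (Icc T₁ T₂)) (hφ'0 : ∀ t ∈ Icc T₁ T₂, φ' t ≤ 0)
    (hφ''0 : ∀ t ∈ Icc T₁ T₂, 0 ≤ φ'' t) (hφT : 0 ≤ φ T₂)
    (hS1 : ∀ t ∈ Icc T₁ T₂, |∫ x in T₁..t, zetaArgS x| ≤ A₀ + A₁ * Real.log t)
    (hQS : ∀ t ∈ Icc T₁ T₂, |((zetaZeroCount t : ℝ) - countMain t) - zetaArgS t| ≤ A₂ / t) :
    |∑ ρ ∈ zerosBetween T₁ T₂, (riemannZetaZeroOrder ρ : ℝ) * φ ρ.im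
        - (∫ t in T₁..T₂, φ t * Real.log (t / (2 * π))) / (2 * π)
        - (((zetaZeroCount T₂ : ℝ) - countMain T₂) * φ T₂
            - ((zetaZeroCount T₁ : ℝ) - countMain T₁) * φ T₁)| ≤
      (A₀ + A₁ * Real.log T₁) * |φ' T₁| + (A₁ + A₂) * φ T₁ / T₁ := by
  have hφ'c : ContinuousOn φ' (Icc T₁ T₂) := fun t ht ↦ (hφ' t ht).continuousAt.continuousWithinAt
  rw [lehman_identity h0 h12 hφ hφ'c]
  have e : (∫ t in T₁..T₂, φ t * Real.log (t / (2 * π))) / (2 * π)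
      + ((zetaZeroCount T₂ : ℝ) - countMain T₂) * φ T₂
      - ((zetaZeroCount T₁ : ℝ) - countMain T₁) * φ T₁
      - (∫ t in T₁..T₂, ((zetaZeroCount t : ℝ) - countMain t) * φ' t)
      - (∫ t in T₁..T₂, φ t * Real.log (t / (2 * π))) / (2 * π)
      - (((zetaZeroCount T₂ : ℝ) - countMain T₂) * φ T₂
          - ((zetaZeroCount T₁ : ℝ) - countMain T₁) * φ T₁) =
      -(∫ t in T₁..T₂, ((zetaZeroCount t : ℝ) - countMain t) * φ' t) := by ring
  rw [e, abs_neg]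
  have h := BrentPlattTrudgian2021_lemma3_E2_base h0 h12 hA₁ hφ hφ' hφ'' hφ'0 hφ''0 hφT hS1 hQS
  rwa [intervalIntegral.integral_same, abs_zero, zero_add] at h

/-! ## Explicit instances -/

/-- The tree's explicit `Q − S` bound in the form `A₂/t`: for `t ≥ 2`,
`|Q(t) − S(t)| = |θ(t)/π + 1 − L(t)| ≤ (1.2/π)/t` (from the tree's Stirling bound for `θ`,
`abs_zetaZeroCount_sub_main_sub_zetaArgS_le`; the source's Lemma 2 has `1/150`).
[cite: BrentPlattTrudgian2021, Lemma 2] -/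
theorem abs_count_sub_countMain_sub_zetaArgS_le {t : ℝ} (ht : 2 ≤ t) :
    |((zetaZeroCount t : ℝ) - countMain t) - zetaArgS t| ≤ (1.2 / π) / t := by
  have h := abs_zetaZeroCount_sub_main_sub_zetaArgS_le ht
  have ht0 : 0 < t := by linarith
  have hlog : Real.log (t / (2 * π * Real.exp 1)) = Real.log (t / (2 * π)) - 1 := by
    rw [show t / (2 * π * Real.exp 1) = t / (2 * π) / Real.exp 1 by ring,
      Real.log_div (by positivity) (Real.exp_pos 1).ne', Real.log_exp]
  have e : (zetaZeroCount t : ℝ) - t / (2 * π) * Real.log (t / (2 * π * Real.exp 1))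
      - zetaArgS t - 7 / 8 = ((zetaZeroCount t : ℝ) - countMain t) - zetaArgS t := by
    rw [hlog, countMain]
    ring
  rw [← e, div_div]
  exact h

set_option maxHeartbeats 400000 in -- unification of the decimal-constant instances is slow
/-- **Lemma 3 above `168π`, explicitly** (RH-free; every input is a tree theorem once
`hTr` is fed `abs_integral_zetaArgS_le_trudgian_holds` of `TuringMethodProofs.lean`): for
`168π < T₁ ≤ T₂` and `φ ∈ C²[T₁,T₂]` with `φ' ≤ 0 ≤ φ''`, `φ(T₂) ≥ 0`,
`|Σ_{T₁<γ≤T₂} m(ρ)φ(γ) − (1/2π)∫φ log(t/2π) − (φ(T₂)Q(T₂) − φ(T₁)Q(T₁))|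
  ≤ (2.067 + 0.059 log T₁)|φ'(T₁)| + (0.059 + 1.2/π)φ(T₁)/T₁`
(Trudgian 2011, Thm 2.2 with the base point `T₁`, so the factor `2` of (3.2) is not needed, and
the tree's `A₂ = 1.2/π`). [cite: BrentPlattTrudgian2021, Lemma 3 and Theorem 1 eq. (1.3)]
[cite: Trudgian2011, Thm. 2.2] -/
theorem BrentPlattTrudgian2021_lemma3_of_trudgian (hTr : abs_integral_zetaArgS_le_trudgian)
    {T₁ T₂ : ℝ} (h1 : 168 * π < T₁) (h12 : T₁ ≤ T₂) {φ φ' φ'' : ℝ → ℝ}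
    (hφ : ∀ t ∈ Icc T₁ T₂, HasDerivAt φ (φ' t) t) (hφ' : ∀ t ∈ Icc T₁ T₂, HasDerivAt φ' (φ'' t) t)
    (hφ'' : ContinuousOn φ'' (Icc T₁ T₂)) (hφ'0 : ∀ t ∈ Icc T₁ T₂, φ' t ≤ 0)
    (hφ''0 : ∀ t ∈ Icc T₁ T₂, 0 ≤ φ'' t) (hφT : 0 ≤ φ T₂) :
    |∑ ρ ∈ zerosBetween T₁ T₂, (riemannZetaZeroOrder ρ : ℝ) * φ ρ.im
        - (∫ t in T₁..T₂, φ t * Real.log (t / (2 * π))) / (2 * π)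
        - (((zetaZeroCount T₂ : ℝ) - countMain T₂) * φ T₂
            - ((zetaZeroCount T₁ : ℝ) - countMain T₁) * φ T₁)| ≤
      (2.067 + 0.059 * Real.log T₁) * |φ' T₁| + (0.059 + 1.2 / π) * φ T₁ / T₁ := by
  have hπ : 3 < π := Real.pi_gt_three
  have h0 : 0 < T₁ := by linarith
  have hS1 : ∀ t ∈ Icc T₁ T₂, |∫ x in T₁..t, zetaArgS x| ≤ 2.067 + 0.059 * Real.log t := by
    intro t ht
    rcases eq_or_lt_of_le ht.1 with h | h
    · rw [← h, intervalIntegral.integral_same, abs_zero]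
      have : 0 ≤ Real.log T₁ := Real.log_nonneg (by linarith)
      positivity
    · exact hTr h1 h
  have hQS : ∀ t ∈ Icc T₁ T₂, |((zetaZeroCount t : ℝ) - countMain t) - zetaArgS t| ≤ (1.2 / π) / t :=
    fun t ht ↦ abs_count_sub_countMain_sub_zetaArgS_le (by linarith [ht.1])
  exact BrentPlattTrudgian2021_lemma3_sharp h0 h12 (by norm_num) hφ hφ' hφ'' hφ'0 hφ''0 hφT hS1 hQS

set_option maxHeartbeats 400000 in -- unification of the decimal-constant instances is slow
/-- **Lemma 3 with the printed constants** (`A₀ = 2.067`, `A₁ = 0.059`, `A₂ = 1/150`, `T₀ = 2π`):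
under the source's standing condition (2.9) on `[2π, ∞)` — the hypothesis `h29`, which is the named
fact `BrentPlattTrudgian2021_eq29` of `ZetaZeroSumsLehmanExplicit.lean` — and its Lemma 2
(`BrentPlattTrudgian2021_lemma2`), for `2π ≤ T₁ ≤ T₂` and `φ ∈ C²[T₁,T₂]` with `φ' ≤ 0 ≤ φ''`,
`φ(T₂) ≥ 0`:
`|Σ_{T₁<γ≤T₂} m(ρ)φ(γ) − (1/2π)∫φ log(t/2π) − (φ(T₂)Q(T₂) − φ(T₁)Q(T₁))|
  ≤ 2(2.067 + 0.059 log T₁)|φ'(T₁)| + (0.059 + 1/150)φ(T₁)/T₁` — the error term of Theorems 1 and 3.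
[cite: BrentPlattTrudgian2021, Lemma 3 (3.2), Theorem 1 (1.3), Theorem 3] -/
theorem BrentPlattTrudgian2021_lemma3_printed
    (h29 : ∀ T : ℝ, 2 * π ≤ T → |∫ t in (168 * π)..T, zetaArgS t| ≤ 2.067 + 0.059 * Real.log T)
    (hL2 : BrentPlattTrudgian2021_lemma2)
    {T₁ T₂ : ℝ} (h1 : 2 * π ≤ T₁) (h12 : T₁ ≤ T₂) {φ φ' φ'' : ℝ → ℝ}
    (hφ : ∀ t ∈ Icc T₁ T₂, HasDerivAt φ (φ' t) t) (hφ' : ∀ t ∈ Icc T₁ T₂, HasDerivAt φ' (φ'' t) t)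
    (hφ'' : ContinuousOn φ'' (Icc T₁ T₂)) (hφ'0 : ∀ t ∈ Icc T₁ T₂, φ' t ≤ 0)
    (hφ''0 : ∀ t ∈ Icc T₁ T₂, 0 ≤ φ'' t) (hφT : 0 ≤ φ T₂) :
    |∑ ρ ∈ zerosBetween T₁ T₂, (riemannZetaZeroOrder ρ : ℝ) * φ ρ.im
        - (∫ t in T₁..T₂, φ t * Real.log (t / (2 * π))) / (2 * π)
        - (((zetaZeroCount T₂ : ℝ) - countMain T₂) * φ T₂
            - ((zetaZeroCount T₁ : ℝ) - countMain T₁) * φ T₁)| ≤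
      2 * (2.067 + 0.059 * Real.log T₁) * |φ' T₁| + (0.059 + 1 / 150) * φ T₁ / T₁ := by
  have hπ : 3 < π := Real.pi_gt_three
  have h0 : 0 < T₁ := by linarith
  have hS1 : ∀ t ∈ Icc T₁ T₂, |∫ x in (168 * π)..t, zetaArgS x| ≤ 2.067 + 0.059 * Real.log t :=
    fun t ht ↦ h29 t (h1.trans ht.1)
  have hQS : ∀ t ∈ Icc T₁ T₂, |((zetaZeroCount t : ℝ) - countMain t) - zetaArgS t| ≤ (1 / 150) / t := by
    intro t ht
    have h := hL2 t (h1.trans ht.1)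
    rwa [div_div]
  exact BrentPlattTrudgian2021_lemma3 h0 h12 (by norm_num) hφ hφ' hφ'' hφ'0 hφ''0 hφT hS1 hQS

end Literature.NumberTheory.LFunctions

end
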